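import Literature.NumberTheory.Automorphic.TorusLieDual
import Literature.NumberTheory.Automorphic.LieAlgebraGLBracket
import Literature.NumberTheory.Automorphic.LieAlgebraGLDimension
import Literature.NumberTheory.Automorphic.GLReindex
import Literature.Algebra.Lie.SimpleBaseChange
import HarnessLib

/-!
# `Lie(g H g⁻¹) = Ad(g) Lie(H)` and `Lie` of a reindexed group: the Lie algebra of a linear group up to the
# isomorphisms `Int(g)` and coordinate permutations — equal dimensions, and SIMPLICITY of `Lie(H)` is invariant

Library `Literature/NumberTheory/Automorphic` (the lane's linear-algebraic-groups library: `lieAlgebraGL`,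
`lieSubalgebraGL`, `IsZConnected.zdim`, `reindexGL`); lane `lit-hodgefound`, prover seat `lit-hodgefound-p17`
(generation 39, self-proposed row g39-#7a, LAG supplier of the Hodge row g39-#7b "every polarised torus with
`Hg(X) = Sp(V, E)` has simple `Lie Hg(X)(ℂ)`": the general symplectic group `Sp(V, E)(ℂ)` of the lane is a
`GL`-conjugate of a reindexed standard `Sp_{2n}(ℂ)` (`ComplexTorusSymplecticGroupGramConnected`), so Lie-simplicity
has to be transported along `Int(g)` and along reindexing). THEOREMS ONLY (no definition, no instance; net debt 0).

Springer [SpringerLAG1998, 4.4.5 (ii)]: "If `x ∈ G` then `Ad x` is an automorphism of the Lie algebra `𝔤`", where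
`Ad x = d(Int x)` and `Int(x) y = x y x⁻¹`; for `G = GL_n`, `Ad(x) X = x X x⁻¹` [SpringerLAG1998, 4.4.10 (3)]. Hence
for a subgroup `H ≤ GL_n`: `L(x H x⁻¹) = Ad(x) L(H)`. A permutation `e` of the coordinates is an isomorphism of
algebraic groups `GL_n ≃ GL_m`, so it preserves `dim` [SpringerLAG1998, 1.8.1, 4.4.6] and maps `L(H)` isomorphically
onto `L(e·H)` [SpringerLAG1998, 4.4.5 (ii), 4.4.10 (3)]; simplicity of a Lie algebra is invariant under isomorphism
[Hall2015, §3.2 Definition 3.11] (the tree's `Literature.Algebra.Lie.SimpleBaseChange.isSimple_of_lieEquiv`).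

## What is proved (`H ≤ GL n k`, `g : GL n k`, `e : n ≃ m`)

* §1 `Int(g)` (on top of `TorusLieDual.mem_lieAlgebraGL_map_conj_iff` ∕ `inv_conj_mem_lieAlgebraGL_of_mem_map_conj`,
  the membership forms already in the tree): `mem_lieAlgebraGL_map_conj_iff_inv_conj_mem` (`A ∈ Lie(gHg⁻¹) ⟺
  g⁻¹ A g ∈ Lie(H)`), **`lieAlgebraGL_map_conj`** (`Lie(gHg⁻¹) = Ad(g) Lie(H)` as subspaces),
  `finrank_lieAlgebraGL_map_conj`, **`isSimple_lieSubalgebraGL_map_conj_iff`** (`Lie(gHg⁻¹)` simple ⟺ `Lie(H)`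
  simple), `isLieAbelian_lieSubalgebraGL_map_conj_iff`.
* §2 reindexing: **`mem_lieAlgebraGL_map_reindexGL_iff`** (`A ∈ Lie(e·H) ⟺ e⁻¹·A ∈ Lie(H)`),
  `reindex_mem_lieAlgebraGL_map_reindexGL_iff`, `finrank_lieAlgebraGL_map_reindexGL`, **`IsZConnected.zdim_map_reindexGL`**,
  **`isSimple_lieSubalgebraGL_map_reindexGL_iff`**, `isLieAbelian_lieSubalgebraGL_map_reindexGL_iff`.

## References

* [SpringerLAG1998] T. A. Springer, *Linear Algebraic Groups*, 2nd ed., Birkhäuser (1998), 1.8.1, 2.1.4, 4.4.5 (ii),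
  4.4.6, 4.4.10 (3).
* [Hall2015] B. C. Hall, *Lie Groups, Lie Algebras, and Representations*, 2nd ed. (2015), §3.2 Definition 3.11.
-/

noncomputable section

open Matrix

namespace Literature.NumberTheory.Automorphic

variable {k : Type*} [Field k] {n : Type*} [Fintype n] [DecidableEq n] {m : Type*} [Fintype m] [DecidableEq m]

/-! ## §0 Simplicity and commutativity of `Lie(H)` along an algebra isomorphism of matrix algebras -/

/-- If an algebra isomorphism `f : M_n(k) ≃ M_m(k)` carries `Lie(H)` onto `Lie(H')`, then `Lie(H)` is a simple Lie
algebra iff `Lie(H')` is, and `Lie(H)` is abelian iff `Lie(H')` is (`f` restricts to a Lie algebra isomorphism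
`Lie(H) ≃ Lie(H')`). [folklore] [cite: Hall2015, §3.2 Definition 3.11] -/
private theorem isSimple_iff_and_isLieAbelian_iff_of_algEquiv (f : Matrix n n k ≃ₐ[k] Matrix m m k)
    {H : Subgroup (GL n k)} {H' : Subgroup (GL m k)} (hf : ∀ A, A ∈ lieAlgebraGL H ↔ f A ∈ lieAlgebraGL H') :
    (LieAlgebra.IsSimple k (lieSubalgebraGL H) ↔ LieAlgebra.IsSimple k (lieSubalgebraGL H')) ∧
      (IsLieAbelian (lieSubalgebraGL H) ↔ IsLieAbelian (lieSubalgebraGL H')) := by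
  letI : LieRing (Matrix n n k) := LieRing.ofAssociativeRing
  letI : LieAlgebra k (Matrix n n k) := LieAlgebra.ofAssociativeAlgebra
  letI : LieRing (Matrix m m k) := LieRing.ofAssociativeRing
  letI : LieAlgebra k (Matrix m m k) := LieAlgebra.ofAssociativeAlgebra
  have hmap : (lieSubalgebraGL H).map (f.toLieEquiv : Matrix n n k →ₗ⁅k⁆ Matrix m m k) = lieSubalgebraGL H' := by
    ext A'
    rw [LieSubalgebra.mem_map, mem_lieSubalgebraGL_iff]
    constructor
    · rintro ⟨A, hA, rfl⟩
      exact (hf A).1 hA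
    · intro hA'
      exact ⟨f.symm A', (hf _).2 (by rwa [f.apply_symm_apply]), f.apply_symm_apply A'⟩
  let e : lieSubalgebraGL H ≃ₗ⁅k⁆ lieSubalgebraGL H' := LieEquiv.ofSubalgebras _ _ f.toLieEquiv hmap
  exact ⟨⟨fun h ↦ Literature.Algebra.Lie.SimpleBaseChange.isSimple_of_lieEquiv e.symm,
    fun h ↦ Literature.Algebra.Lie.SimpleBaseChange.isSimple_of_lieEquiv e⟩, lie_abelian_iff_equiv_lie_abelian e⟩

/-! ## §1 `Lie(g H g⁻¹) = Ad(g) Lie(H)` -/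

section Conj

variable (H : Subgroup (GL n k)) (g : GL n k)

/-- **`A ∈ Lie(g H g⁻¹) ⟺ g⁻¹ A g ∈ Lie(H)`** (`Ad(g) = d Int(g)` is a bijection `Lie(H) → Lie(gHg⁻¹)`; the
tree's `mem_lieAlgebraGL_map_conj_iff` is the form `g A g⁻¹ ∈ Lie(gHg⁻¹) ⟺ A ∈ Lie(H)`).
[cite: SpringerLAG1998, 4.4.5 (ii) and 4.4.10 (3)] -/
theorem mem_lieAlgebraGL_map_conj_iff_inv_conj_mem {A : Matrix n n k} :
    A ∈ lieAlgebraGL (H.map (MulAut.conj g : GL n k →* GL n k)) ↔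
      ((g⁻¹ : GL n k) : Matrix n n k) * A * (g : Matrix n n k) ∈ lieAlgebraGL H := by
  refine ⟨inv_conj_mem_lieAlgebraGL_of_mem_map_conj g, fun hA ↦ ?_⟩
  have h := conj_mem_lieAlgebraGL_map_conj g hA
  rwa [units_conj_inv_conj] at h

/-- **`Lie(g H g⁻¹) = Ad(g) Lie(H)`** (as subspaces of `𝔤𝔩_n`; `adGL g A = g A g⁻¹`).
[cite: SpringerLAG1998, 4.4.5 (ii) and 4.4.10 (3)] -/
theorem lieAlgebraGL_map_conj :
    lieAlgebraGL (H.map (MulAut.conj g : GL n k →* GL n k)) = (lieAlgebraGL H).map (adGL g) := by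
  ext A
  rw [mem_lieAlgebraGL_map_conj_iff_inv_conj_mem, Submodule.mem_map]
  constructor
  · intro hA
    exact ⟨_, hA, by rw [adGL_apply, units_conj_inv_conj]⟩
  · rintro ⟨B, hB, rfl⟩
    rwa [adGL_apply, units_inv_conj_conj]

/-- **`dim Lie(g H g⁻¹) = dim Lie(H)`.** [cite: SpringerLAG1998, 4.4.5 (ii)] -/
theorem finrank_lieAlgebraGL_map_conj :
    Module.finrank k (lieAlgebraGL (H.map (MulAut.conj g : GL n k →* GL n k))) = Module.finrank k (lieAlgebraGL H) := by
  have hinj : Function.Injective (adGL (k := k) g) :=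
    Function.LeftInverse.injective (g := adGL g⁻¹) fun A ↦ by rw [adGL_apply, adGL_apply, inv_inv, units_inv_conj_conj]
  rw [lieAlgebraGL_map_conj]
  exact (LinearEquiv.finrank_eq (Submodule.equivMapOfInjective _ hinj _)).symm

/-- `Int(g) : X ↦ g X g⁻¹` as an algebra automorphism of `M_n(k)` carries `Lie(H)` onto `Lie(gHg⁻¹)`. [folklore] -/
private theorem exists_algEquiv_conj :
    ∃ f : Matrix n n k ≃ₐ[k] Matrix n n k,
      ∀ A, A ∈ lieAlgebraGL H ↔ f A ∈ lieAlgebraGL (H.map (MulAut.conj g : GL n k →* GL n k)) := by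
  let L : Matrix n n k ≃ₗ[k] Matrix n n k :=
    { toLinearMap := adGL g
      invFun := adGL g⁻¹
      left_inv := fun A ↦ by
        change adGL g⁻¹ (adGL g A) = A
        rw [adGL_apply, adGL_apply, inv_inv, units_inv_conj_conj]
      right_inv := fun A ↦ by
        change adGL g (adGL g⁻¹ A) = A
        rw [adGL_apply, adGL_apply, inv_inv, units_conj_inv_conj] }
  have hL : ∀ A, L A = (g : Matrix n n k) * A * ((g⁻¹ : GL n k) : Matrix n n k) := fun A ↦ adGL_apply g A
  refine ⟨AlgEquiv.ofLinearEquiv L ?_ ?_, fun A ↦ ?_⟩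
  · rw [hL, Matrix.mul_one, Units.mul_inv]
  · intro x y
    rw [hL, hL, hL, Matrix.mul_assoc ((g : Matrix n n k) * x), ← Matrix.mul_assoc ((g⁻¹ : GL n k) : Matrix n n k),
      ← Matrix.mul_assoc ((g⁻¹ : GL n k) : Matrix n n k), Units.inv_mul, Matrix.one_mul, ← Matrix.mul_assoc,
      ← Matrix.mul_assoc]
  · rw [AlgEquiv.ofLinearEquiv_apply, hL, mem_lieAlgebraGL_map_conj_iff]

/-- **`Lie(g H g⁻¹)` IS SIMPLE IFF `Lie(H)` IS** (`Ad(g)` is a Lie algebra isomorphism `Lie(H) ≃ Lie(gHg⁻¹)`).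
[cite: SpringerLAG1998, 4.4.5 (ii)] [cite: Hall2015, §3.2 Definition 3.11] -/
theorem isSimple_lieSubalgebraGL_map_conj_iff :
    LieAlgebra.IsSimple k (lieSubalgebraGL (H.map (MulAut.conj g : GL n k →* GL n k))) ↔
      LieAlgebra.IsSimple k (lieSubalgebraGL H) := by
  obtain ⟨f, hf⟩ := exists_algEquiv_conj H g
  exact (isSimple_iff_and_isLieAbelian_iff_of_algEquiv f hf).1.symm

/-- `Lie(g H g⁻¹)` is abelian iff `Lie(H)` is. [cite: SpringerLAG1998, 4.4.5 (ii)] -/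
theorem isLieAbelian_lieSubalgebraGL_map_conj_iff :
    IsLieAbelian (lieSubalgebraGL (H.map (MulAut.conj g : GL n k →* GL n k))) ↔ IsLieAbelian (lieSubalgebraGL H) := by
  obtain ⟨f, hf⟩ := exists_algEquiv_conj H g
  exact (isSimple_iff_and_isLieAbelian_iff_of_algEquiv f hf).2.symm

end Conj

/-! ## §2 `Lie` of a reindexed group -/

section Reindex

variable (H : Subgroup (GL n k)) (e : n ≃ m)

omit [DecidableEq n] [DecidableEq m] in
/-- The trace is invariant under reindexing. [folklore] -/
private theorem trace_reindex (A : Matrix n n k) : Matrix.trace (Matrix.reindex e e A) = Matrix.trace A := by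
  simp only [Matrix.trace, Matrix.reindex_apply, Matrix.diag_apply, Matrix.submatrix_apply]
  exact Equiv.sum_comp e.symm (fun i ↦ A i i)

/-- The dual point `1 + εA` of `GL_m` read in the `e`-renamed coordinates is the dual point `1 + ε(e⁻¹·A)` of `GL_n`.
[folklore] [cite: SpringerLAG1998, 4.1.9 (3)] -/
private theorem dualPoint_comp_coordMap (A : Matrix m m k) :
    dualPoint A ∘ coordMap e = dualPoint (Matrix.reindex e.symm e.symm A) := by
  funext c
  rcases c with ⟨i, j⟩ | ⟨⟩
  · simp [dualPoint, coordMap, tangentCoord, Matrix.one_apply]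
  · simp only [dualPoint, coordMap, tangentCoord, Function.comp_apply, Sum.map_inr, id_eq, Sum.elim_inr]
    rw [trace_reindex]
    simp [glCoordFun]

/-- Renaming the coordinates along `e` maps the vanishing ideal of `H` into that of `e·H`. [folklore]
[cite: SpringerLAG1998, 2.1.4] -/
private theorem rename_coordMap_mem_vanishingIdeal {p : MvPolynomial (GLCoord n) k}
    (hp : p ∈ MvPolynomial.vanishingIdeal k (glCoordFun '' (H : Set (GL n k)))) :
    MvPolynomial.rename (coordMap e) p ∈
      MvPolynomial.vanishingIdeal k (glCoordFun '' ((H.map (reindexGL e).toMonoidHom : Subgroup (GL m k)) : Set (GL m k))) := by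
  rw [MvPolynomial.mem_vanishingIdeal_iff] at hp ⊢
  rintro _ ⟨g', hg', rfl⟩
  obtain ⟨g, hg, rfl⟩ := Subgroup.mem_map.1 hg'
  change MvPolynomial.eval (glCoordFun (reindexGL e g)) _ = 0
  rw [eval_rename_coordMap]
  exact hp _ ⟨g, hg, rfl⟩

/-- `A ∈ Lie(e·H) ⟹ e⁻¹·A ∈ Lie(H)`. [cite: SpringerLAG1998, 4.4.5 (ii) and 4.1.9 (3)] -/
theorem reindex_symm_mem_lieAlgebraGL_of_mem_map_reindexGL {A : Matrix m m k}
    (hA : A ∈ lieAlgebraGL (H.map (reindexGL e).toMonoidHom)) : Matrix.reindex e.symm e.symm A ∈ lieAlgebraGL H := by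
  rw [mem_lieAlgebraGL_iff_aeval] at hA ⊢
  intro p hp
  rw [← dualPoint_comp_coordMap, ← MvPolynomial.aeval_rename]
  exact hA _ (rename_coordMap_mem_vanishingIdeal H e hp)

/-- **`A ∈ Lie(e·H) ⟺ e⁻¹·A ∈ Lie(H)`** (reindexing is an isomorphism of algebraic groups `GL_n ≃ GL_m`).
[cite: SpringerLAG1998, 4.4.5 (ii) and 4.4.10 (3)] -/
theorem mem_lieAlgebraGL_map_reindexGL_iff {A : Matrix m m k} :
    A ∈ lieAlgebraGL (H.map (reindexGL e).toMonoidHom) ↔ Matrix.reindex e.symm e.symm A ∈ lieAlgebraGL H := by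
  refine ⟨reindex_symm_mem_lieAlgebraGL_of_mem_map_reindexGL H e, fun hA ↦ ?_⟩
  have h := reindex_symm_mem_lieAlgebraGL_of_mem_map_reindexGL (H.map (reindexGL e).toMonoidHom) e.symm
    (A := Matrix.reindex e.symm e.symm A) (by rwa [map_reindexGL_symm_map])
  simpa only [Equiv.symm_symm, Matrix.reindex_apply, Matrix.submatrix_submatrix, Equiv.symm_comp_self,
    Equiv.self_comp_symm, Matrix.submatrix_id_id] using h

/-- `e·A ∈ Lie(e·H) ⟺ A ∈ Lie(H)`. [cite: SpringerLAG1998, 4.4.5 (ii)] -/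
theorem reindex_mem_lieAlgebraGL_map_reindexGL_iff {A : Matrix n n k} :
    Matrix.reindex e e A ∈ lieAlgebraGL (H.map (reindexGL e).toMonoidHom) ↔ A ∈ lieAlgebraGL H := by
  rw [mem_lieAlgebraGL_map_reindexGL_iff]
  simp only [Matrix.reindex_apply, Matrix.submatrix_submatrix, Equiv.self_comp_symm, Matrix.submatrix_id_id]

/-- The reindexing algebra isomorphism `M_n(k) ≃ M_m(k)` carries `Lie(H)` onto `Lie(e·H)`. [folklore] -/
private theorem exists_algEquiv_reindex :
    ∃ f : Matrix n n k ≃ₐ[k] Matrix m m k, ∀ A, A ∈ lieAlgebraGL H ↔ f A ∈ lieAlgebraGL (H.map (reindexGL e).toMonoidHom) :=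
  ⟨Matrix.reindexAlgEquiv k k e, fun A ↦ by
    rw [Matrix.coe_reindexAlgEquiv, reindex_mem_lieAlgebraGL_map_reindexGL_iff]⟩

/-- **`dim Lie(e·H) = dim Lie(H)`.** [cite: SpringerLAG1998, 4.4.5 (ii)] -/
theorem finrank_lieAlgebraGL_map_reindexGL :
    Module.finrank k (lieAlgebraGL (H.map (reindexGL e).toMonoidHom)) = Module.finrank k (lieAlgebraGL H) := by
  let L : Matrix n n k ≃ₗ[k] Matrix m m k := (Matrix.reindexAlgEquiv k k e).toLinearEquiv
  have hmap : (lieAlgebraGL H).map (L : Matrix n n k →ₗ[k] Matrix m m k) = lieAlgebraGL (H.map (reindexGL e).toMonoidHom) := by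
    ext A'
    rw [Submodule.mem_map]
    constructor
    · rintro ⟨A, hA, rfl⟩
      exact (reindex_mem_lieAlgebraGL_map_reindexGL_iff H e).2 hA
    · intro hA'
      refine ⟨Matrix.reindex e.symm e.symm A', (mem_lieAlgebraGL_map_reindexGL_iff H e).1 hA', ?_⟩
      change Matrix.reindex e e (Matrix.reindex e.symm e.symm A') = A'
      simp only [Matrix.reindex_apply, Matrix.submatrix_submatrix, Equiv.symm_comp_self, Matrix.submatrix_id_id]
  rw [← hmap]
  exact (LinearEquiv.finrank_eq (Submodule.equivMapOfInjective _ L.injective _)).symm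

variable {H} in
/-- **`dim (e·H) = dim H`** for Zariski-connected `H` (over a perfect field, through `dim Lie = dim`).
[cite: SpringerLAG1998, 1.8.1 and 4.4.6] -/
theorem IsZConnected.zdim_map_reindexGL [PerfectField k] (hH : IsZConnected H) :
    (hH.map_reindexGL e).zdim = hH.zdim := by
  rw [← hH.finrank_lieAlgebraGL_eq.2, ← (hH.map_reindexGL e).finrank_lieAlgebraGL_eq.2, finrank_lieAlgebraGL_map_reindexGL]

/-- **`Lie(e·H)` IS SIMPLE IFF `Lie(H)` IS.** [cite: SpringerLAG1998, 4.4.5 (ii)] [cite: Hall2015, §3.2 Definition 3.11] -/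
theorem isSimple_lieSubalgebraGL_map_reindexGL_iff :
    LieAlgebra.IsSimple k (lieSubalgebraGL (H.map (reindexGL e).toMonoidHom)) ↔ LieAlgebra.IsSimple k (lieSubalgebraGL H) := by
  obtain ⟨f, hf⟩ := exists_algEquiv_reindex H e
  exact (isSimple_iff_and_isLieAbelian_iff_of_algEquiv f hf).1.symm

/-- `Lie(e·H)` is abelian iff `Lie(H)` is. [cite: SpringerLAG1998, 4.4.5 (ii)] -/
theorem isLieAbelian_lieSubalgebraGL_map_reindexGL_iff :
    IsLieAbelian (lieSubalgebraGL (H.map (reindexGL e).toMonoidHom)) ↔ IsLieAbelian (lieSubalgebraGL H) := by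
  obtain ⟨f, hf⟩ := exists_algEquiv_reindex H e
  exact (isSimple_iff_and_isLieAbelian_iff_of_algEquiv f hf).2.symm

end Reindex

end Literature.NumberTheory.Automorphic

end
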